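import Summits.RiemannHypothesis.RiemannHypothesis.Theorems.WeilFormatCCinfArchMonomials
import Summits.RiemannHypothesis.RiemannHypothesis.Theorems.WeilFormatCTailEvenJ
import Summits.RiemannHypothesis.RiemannHypothesis.Theorems.WeilFormatCTailOddJ
import HarnessLib

/-!
# Format C, design C∞ (E3, analytic side): the far ROWS `M^±(i,m)` as MONOMIAL sums in the tags `1`, `S_m`

Route context: Fourier–Galerkin / Schur-complement certificates of Weil positivity on a window ("format C", C∞ door;
cell memo `run/shared/lean/pub/rh-explicit/rh-explicit-weil-10/KERNEL-LEVER.md` §21; supporting stmt-RiemannHypothesis-0098;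
seat rh-explicit-weil-10).  `abs_evenKernel_col_sub_families_le` / `abs_oddKernel_col_sub_families_le`
(`WeilFormatCTailEvenJ/OddJ`) write the far column entries `M⁺(i,m)`, `M⁻(i,m)` (`2i ≤ m`) of the sector kernels as
`(−1)^m[(F_m/π)·(pure powers) + (pure powers with the block constants F_i, c_i, d_i)] + O((i/m)^{2J}/m)`, with ONE mode
function `F_m = ½Im ψ(¼+iω_m/2) + S_m − T_m = J_s(m) + S_m` (`modeFunction_eq_setIntegral_sin_add`).  Substituting
the monomial form of `J_s(m)` (`abs_archSin_sub_monomials_le`) gives, for natural modes `m ≥ m₀ ≥ 2i`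
(`πm₀/a ≥ 2`) and a uniform order `E` (`E + 1 ≤ 2ν`, `E ≤ K`, `E ≤ 2R`, `E ≤ 2J`):

* `abs_evenRow_sub_monomials_le` — `M⁺(i,m) = (−1)^m[((J_s-monomials + S_m)/π)·Σ_{j<J}(−1)^i i^{2j}/m^{2j+1}`
  `  + Σ_{r<J}(−1)^i(−i^{2r+1}F_i/π + (4s²/a)(−1)^r q^{r+1}c_i)/m^{2r+2}] ± ρ⁺(i,m₀)·(m₀/m)^{E+1}`;
* `abs_oddRow_sub_monomials_le` — `M⁻(i,m) = (−1)^m[((J_s-monomials + S_m)/π)·Σ_{j<J}(−1)^i i^{2j+1}/m^{2j+2}`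
  `  + Σ_{r<J}(−1)^i(−i^{2r}F_i/π − (4s²/π)(−1)^r q^r d_i)/m^{2r+1}] ± ρ⁻(i,m₀)·(m₀/m)^{E+1}`,

`ρ^±(i,m₀) = remS(m₀)/π·Σ_{j<J} i^{2j(+1)}/m₀^{2j+1(+1)} + (2C_F i^{2J}/π + polar constant)/m₀^{2J+1}`.  So every far
row of the C∞ coupling column is `(−1)^m ×` a finite list of monomials `c·T(m)/m^e`, `T ∈ {1, S_m}`, with
coefficients that are finite sums of rationals, powers of `i`, `a`, `π`, the node moments `D_s(a)` and the block
constants `F_i`, `c_i`/`d_i` (boxes from the light table), plus ONE remainder constant at `m₀ = B₃` — the `hM`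
hypothesis of `coupling_majorant_gram_shifted` after collection by `(T, e)`.  Pure algebra over the landed bounds;
standard axioms; no definitions; no RH claim.
-/

set_option autoImplicit false
-- `Summit.RiemannHypothesis.RiemannHypothesis.…` is the layout-mandated namespace (summit = problem name).
set_option linter.dupNamespace false

noncomputable section

open Complex Filter Set MeasureTheory
open scoped Real Topology ArithmeticFunction.vonMangoldt

namespace Summit.RiemannHypothesis.RiemannHypothesis.Theorems.WeilFormatC

open Literature.NumberTheory.LFunctions Literature.NumberTheory.LFunctions.Yoshida1992
  Literature.Analysis.SpecialFunctions

variable {a : ℝ}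

/-! ## The substitution step -/

/-- **Substitution template for the rows.**  If `|X − ε((F/π)·A + B)| ≤ ρ₀` with `F = J_s + S`, `|ε| = 1`,
`|J_s − J_s'| ≤ ρ_S·y`, `|A| ≤ A₀` and `ρ₀ ≤ ρ₁·y`, then `|X − ε(((J_s' + S)/π)·A + B)| ≤ (ρ_S/π·A₀ + ρ₁)·y`. -/
theorem abs_sub_le_of_row_template {X ε F Js Js' S A B ρ₀ ρ₁ ρS A₀ y : ℝ} (hε : |ε| = 1)
    (hX : |X - ε * (F / π * A + B)| ≤ ρ₀) (hF : F = Js + S) (hS : |Js - Js'| ≤ ρS * y) (hA : |A| ≤ A₀)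
    (hρ : ρ₀ ≤ ρ₁ * y) (hy : 0 ≤ y) (hρS : 0 ≤ ρS) :
    |X - ε * ((Js' + S) / π * A + B)| ≤ (ρS / π * A₀ + ρ₁) * y := by
  have hdec : X - ε * ((Js' + S) / π * A + B) = (X - ε * (F / π * A + B)) + ε * ((Js - Js') / π * A) := by
    rw [hF]; ring
  rw [hdec]
  calc |(X - ε * (F / π * A + B)) + ε * ((Js - Js') / π * A)|
      ≤ |X - ε * (F / π * A + B)| + |ε * ((Js - Js') / π * A)| := abs_add_le _ _
    _ ≤ ρ₁ * y + ρS * y / π * A₀ := by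
        refine add_le_add (hX.trans hρ) ?_
        rw [abs_mul, hε, one_mul, abs_mul, abs_div, abs_of_pos Real.pi_pos]
        exact mul_le_mul (div_le_div_of_nonneg_right hS Real.pi_pos.le) hA (abs_nonneg _) (by positivity)
    _ = (ρS / π * A₀ + ρ₁) * y := by ring

/-- The pure-power row sums are dominated at `m₀`: for `0 < m₀ ≤ m`,
`|Σ_{j<J} (−1)^i i^{p j}/m^{e j}| ≤ Σ_{j<J} i^{p j}/m₀^{e j}`. -/
theorem abs_sum_sign_pow_div_le {m₀ m : ℝ} (hm₀ : 0 < m₀) (hm : m₀ ≤ m) (i J : ℕ) (p e : ℕ → ℕ) :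
    |∑ j ∈ Finset.range J, ((-1 : ℝ) ^ i * (i : ℝ) ^ (p j)) / m ^ (e j)|
      ≤ ∑ j ∈ Finset.range J, (i : ℝ) ^ (p j) / m₀ ^ (e j) := by
  refine (Finset.abs_sum_le_sum_abs _ _).trans (Finset.sum_le_sum fun j _ ↦ ?_)
  rw [abs_div, abs_mul, abs_pow, abs_neg, abs_one, one_pow, one_mul, abs_pow, Nat.abs_cast,
    abs_of_pos (pow_pos (hm₀.trans_le hm) _)]
  exact div_le_div_of_nonneg_left (by positivity) (pow_pos hm₀ _) (pow_le_pow_left₀ hm₀.le hm _)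

/-! ## The even rows -/

/-- **The far even rows as monomial sums** (`a > 0`; natural modes `m ≥ m₀ ≥ 2i`, `πm₀/a ≥ 2`; `ν ≥ 1`, `2ν ≤ K`;
uniform order `E` with `E + 1 ≤ 2ν`, `E ≤ K`, `E ≤ 2R`, `E ≤ 2J`): `abs_evenKernel_col_sub_families_le` with the mode
function `F_m` replaced by `(J_s-monomials)(m) + S_m`, up to `ρ⁺(i,m₀)·(m₀/m)^{E+1}`. -/
theorem abs_evenRow_sub_monomials_le (ha : 0 < a) {m₀ m : ℕ} (hm₀ : 2 ≤ π * m₀ / a) (hmm : m₀ ≤ m) {i : ℕ}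
    (him : 2 * i ≤ m₀) {ν : ℕ} (hν : ν ≠ 0) {K : ℕ} (hK : 2 * ν ≤ K) (R J : ℕ) {E : ℕ} (hE1 : E + 1 ≤ 2 * ν)
    (hE2 : E ≤ K) (hE3 : E ≤ 2 * R) (hEJ : E ≤ 2 * J) :
    |(if i = 0 then gramCoeff a 0 m else if m = 0 then gramCoeff a i 0
        else (gramCoeff a i m + gramCoeff a i (-(m : ℤ))) / 2)
      - (-1 : ℝ) ^ m *
        (((π / 4
              + ∑ N ∈ Finset.Icc 1 K, (if N % 4 = 1 then (1 : ℝ) else if N % 4 = 3 then -1 else 0)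
                  * (1 - 1 / (2 * (N : ℝ))
                      - (∑ l ∈ Finset.Icc 1 ν, (bernoulli (2 * l) : ℝ) / (2 * l) * 16 ^ l
                          * (((N - 1).choose (2 * l - 1) : ℕ) : ℝ)) / 2)
                  * (a / (2 * π)) ^ N / (m : ℝ) ^ N
              - ∑ r ∈ Finset.range R, (-1 : ℝ) ^ r *
                  (∑' l : ℕ, Real.exp (-(2 * a * digammaNode l)) * digammaNode l ^ (2 * r))
                  * (a / π) ^ (2 * r + 1) / (m : ℝ) ^ (2 * r + 1))
            + ∑ n ∈ weilPrimeIndex a, (Λ n : ℝ) / Real.sqrt n * Real.sin (π * m / a * Real.log n)) / π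
            * ∑ j ∈ Finset.range J, ((-1 : ℝ) ^ i * (i : ℝ) ^ (2 * j)) / (m : ℝ) ^ (2 * j + 1)
          + ∑ r ∈ Finset.range J, ((-1 : ℝ) ^ i *
              (-((i : ℝ) ^ (2 * r + 1)) * ((Complex.digamma (1 / 4 + ((freq a i : ℝ) : ℂ) / 2 * I)).im / 2
                  + (∑ k ∈ weilPrimeIndex a, (Λ k : ℝ) / Real.sqrt k * Real.sin (freq a i * Real.log k))
                  - archExpSumSin a i) / π
                + 4 / a * (Real.exp (a / 2) - Real.exp (-(a / 2))) ^ 2 * (-1 : ℝ) ^ r * (a ^ 2 / (4 * π ^ 2)) ^ (r + 1)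
                  * (1 / (1 + 4 * freq a i ^ 2)))) / (m : ℝ) ^ (2 * r + 2))|
      ≤ (((4 * Real.pi ^ 2 / 3 * ((2 * ν + 1).factorial : ℝ) / (2 * Real.pi) ^ (2 * ν + 1)
                * (4 * (1 / (4 * (π * m₀ / a / 2)))) ^ (2 * ν)
              + (1 / (4 * (π * m₀ / a / 2))) ^ (K + 1) / ((K + 1) * (1 - 1 / (4 * (π * m₀ / a / 2))))
              + 2 * (1 / (4 * (π * m₀ / a / 2))) ^ (K + 1)
              + ∑ k ∈ Finset.Icc 1 ν, |(bernoulli (2 * k) : ℝ) / (2 * k)| * 2 ^ (K + 1 + 4 * k)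
                  * (1 / (4 * (π * m₀ / a / 2))) ^ (K + 1)) / 2
            + (∑' k : ℕ, Real.exp (-(2 * a * digammaNode k)) * digammaNode k ^ (2 * R))
                / |π * m₀ / a| ^ (2 * R + 1)) / π
            * ∑ j ∈ Finset.range J, (i : ℝ) ^ (2 * j) / (m₀ : ℝ) ^ (2 * j + 1)
          + (2 * (π / 4 + (∑ k ∈ weilPrimeIndex a, (Λ k : ℝ) / Real.sqrt k) + a * (1 + weilArchDensity (2 * a)) / π)
                * (i : ℝ) ^ (2 * J) / π
              + 4 / a * (Real.exp (a / 2) - Real.exp (-(a / 2))) ^ 2 * (a ^ 2 / (4 * π ^ 2)) ^ (J + 1)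
                * (1 / (1 + 4 * freq a i ^ 2))) / (m₀ : ℝ) ^ (2 * J + 1))
        * ((m₀ : ℝ) / m) ^ (E + 1) := by
  have hm₀pos : (0 : ℝ) < m₀ := by
    rcases Nat.eq_zero_or_pos m₀ with h0 | h0
    · exfalso; subst h0; norm_num at hm₀
    · exact_mod_cast h0
  have hmm' : (m₀ : ℝ) ≤ m := by exact_mod_cast hmm
  have hmpos : (0 : ℝ) < m := hm₀pos.trans_le hmm'
  have hm1 : 1 ≤ m := by exact_mod_cast hmpos
  have hε : |(-1 : ℝ) ^ m| = 1 := by rw [abs_pow, abs_neg, abs_one, one_pow]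
  have hX := abs_evenKernel_col_sub_families_le ha hm1 (him.trans hmm) J
  have hF := modeFunction_eq_setIntegral_sin_add ha m
  have hS := abs_archSin_sub_monomials_le ha hm₀ hmm hν hK R hE1 hE2 hE3
  have hA := abs_sum_sign_pow_div_le hm₀pos hmm' i J (fun j ↦ 2 * j) (fun j ↦ 2 * j + 1)
  have hΛ : 0 ≤ ∑ k ∈ weilPrimeIndex a, (Λ k : ℝ) / Real.sqrt k :=
    Finset.sum_nonneg fun k _ ↦ div_nonneg ArithmeticFunction.vonMangoldt_nonneg (Real.sqrt_nonneg _)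
  have hEa : 0 < weilArchDensity (2 * a) := weilArchDensity_pos (by linarith)
  have hs2 : 0 ≤ (Real.exp (a / 2) - Real.exp (-(a / 2))) ^ 2 := sq_nonneg _
  have hρ := div_pow_le_scaled (E := E) (n := 2 * J + 1)
    (c := 2 * (π / 4 + (∑ k ∈ weilPrimeIndex a, (Λ k : ℝ) / Real.sqrt k) + a * (1 + weilArchDensity (2 * a)) / π)
        * (i : ℝ) ^ (2 * J) / π
      + 4 / a * (Real.exp (a / 2) - Real.exp (-(a / 2))) ^ 2 * (a ^ 2 / (4 * π ^ 2)) ^ (J + 1)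
        * (1 / (1 + 4 * freq a i ^ 2)))
    (by positivity) hm₀pos hmm' (by omega)
  exact abs_sub_le_of_row_template hε hX hF hS hA hρ (by positivity)
    (archRemainder_nonneg hm₀ ν K (2 * R + 1)
      (tsum_nonneg fun k ↦ mul_nonneg (Real.exp_nonneg _) (pow_nonneg (digammaNode_pos k).le _)))

/-! ## The odd rows -/

/-- **The far odd rows as monomial sums** (`a > 0`; natural modes `m ≥ m₀ ≥ 2i`, `i ≥ 1`, `πm₀/a ≥ 2`; `ν ≥ 1`,
`2ν ≤ K`; uniform order `E` with `E + 1 ≤ 2ν`, `E ≤ K`, `E ≤ 2R`, `E ≤ 2J`): `abs_oddKernel_col_sub_families_le` with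
the mode function `F_m` replaced by `(J_s-monomials)(m) + S_m`, up to `ρ⁻(i,m₀)·(m₀/m)^{E+1}`. -/
theorem abs_oddRow_sub_monomials_le (ha : 0 < a) {m₀ m : ℕ} (hm₀ : 2 ≤ π * m₀ / a) (hmm : m₀ ≤ m) {i : ℕ}
    (hi : 1 ≤ i) (him : 2 * i ≤ m₀) {ν : ℕ} (hν : ν ≠ 0) {K : ℕ} (hK : 2 * ν ≤ K) (R J : ℕ) {E : ℕ}
    (hE1 : E + 1 ≤ 2 * ν) (hE2 : E ≤ K) (hE3 : E ≤ 2 * R) (hEJ : E ≤ 2 * J) :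
    |(gramCoeff a i m - gramCoeff a i (-(m : ℤ))) / 2
      - (-1 : ℝ) ^ m *
        (((π / 4
              + ∑ N ∈ Finset.Icc 1 K, (if N % 4 = 1 then (1 : ℝ) else if N % 4 = 3 then -1 else 0)
                  * (1 - 1 / (2 * (N : ℝ))
                      - (∑ l ∈ Finset.Icc 1 ν, (bernoulli (2 * l) : ℝ) / (2 * l) * 16 ^ l
                          * (((N - 1).choose (2 * l - 1) : ℕ) : ℝ)) / 2)
                  * (a / (2 * π)) ^ N / (m : ℝ) ^ N
              - ∑ r ∈ Finset.range R, (-1 : ℝ) ^ r *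
                  (∑' l : ℕ, Real.exp (-(2 * a * digammaNode l)) * digammaNode l ^ (2 * r))
                  * (a / π) ^ (2 * r + 1) / (m : ℝ) ^ (2 * r + 1))
            + ∑ n ∈ weilPrimeIndex a, (Λ n : ℝ) / Real.sqrt n * Real.sin (π * m / a * Real.log n)) / π
            * ∑ j ∈ Finset.range J, ((-1 : ℝ) ^ i * (i : ℝ) ^ (2 * j + 1)) / (m : ℝ) ^ (2 * j + 2)
          + ∑ r ∈ Finset.range J, ((-1 : ℝ) ^ i *
              (-((i : ℝ) ^ (2 * r)) * ((Complex.digamma (1 / 4 + ((freq a i : ℝ) : ℂ) / 2 * I)).im / 2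
                  + (∑ k ∈ weilPrimeIndex a, (Λ k : ℝ) / Real.sqrt k * Real.sin (freq a i * Real.log k))
                  - archExpSumSin a i) / π
                - 4 * (Real.exp (a / 2) - Real.exp (-(a / 2))) ^ 2 / π * (-1 : ℝ) ^ r * (a ^ 2 / (4 * π ^ 2)) ^ r
                  * (freq a i / (1 + 4 * freq a i ^ 2)))) / (m : ℝ) ^ (2 * r + 1))|
      ≤ (((4 * Real.pi ^ 2 / 3 * ((2 * ν + 1).factorial : ℝ) / (2 * Real.pi) ^ (2 * ν + 1)
                * (4 * (1 / (4 * (π * m₀ / a / 2)))) ^ (2 * ν)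
              + (1 / (4 * (π * m₀ / a / 2))) ^ (K + 1) / ((K + 1) * (1 - 1 / (4 * (π * m₀ / a / 2))))
              + 2 * (1 / (4 * (π * m₀ / a / 2))) ^ (K + 1)
              + ∑ k ∈ Finset.Icc 1 ν, |(bernoulli (2 * k) : ℝ) / (2 * k)| * 2 ^ (K + 1 + 4 * k)
                  * (1 / (4 * (π * m₀ / a / 2))) ^ (K + 1)) / 2
            + (∑' k : ℕ, Real.exp (-(2 * a * digammaNode k)) * digammaNode k ^ (2 * R))
                / |π * m₀ / a| ^ (2 * R + 1)) / π
            * ∑ j ∈ Finset.range J, (i : ℝ) ^ (2 * j + 1) / (m₀ : ℝ) ^ (2 * j + 2)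
          + (2 * (π / 4 + (∑ k ∈ weilPrimeIndex a, (Λ k : ℝ) / Real.sqrt k) + a * (1 + weilArchDensity (2 * a)) / π)
                * (i : ℝ) ^ (2 * J) / π
              + 4 * (Real.exp (a / 2) - Real.exp (-(a / 2))) ^ 2 / π * (a ^ 2 / (4 * π ^ 2)) ^ J
                * (freq a i / (1 + 4 * freq a i ^ 2))) / (m₀ : ℝ) ^ (2 * J + 1))
        * ((m₀ : ℝ) / m) ^ (E + 1) := by
  have hm₀pos : (0 : ℝ) < m₀ := by
    rcases Nat.eq_zero_or_pos m₀ with h0 | h0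
    · exfalso; subst h0; norm_num at hm₀
    · exact_mod_cast h0
  have hmm' : (m₀ : ℝ) ≤ m := by exact_mod_cast hmm
  have hmpos : (0 : ℝ) < m := hm₀pos.trans_le hmm'
  have hε : |(-1 : ℝ) ^ m| = 1 := by rw [abs_pow, abs_neg, abs_one, one_pow]
  have hX := abs_oddKernel_col_sub_families_le ha hi (him.trans hmm) J
  have hF := modeFunction_eq_setIntegral_sin_add ha m
  have hS := abs_archSin_sub_monomials_le ha hm₀ hmm hν hK R hE1 hE2 hE3
  have hA := abs_sum_sign_pow_div_le hm₀pos hmm' i J (fun j ↦ 2 * j + 1) (fun j ↦ 2 * j + 2)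
  have hΛ : 0 ≤ ∑ k ∈ weilPrimeIndex a, (Λ k : ℝ) / Real.sqrt k :=
    Finset.sum_nonneg fun k _ ↦ div_nonneg ArithmeticFunction.vonMangoldt_nonneg (Real.sqrt_nonneg _)
  have hEa : 0 < weilArchDensity (2 * a) := weilArchDensity_pos (by linarith)
  have hs2 : 0 ≤ (Real.exp (a / 2) - Real.exp (-(a / 2))) ^ 2 := sq_nonneg _
  have hdi : 0 ≤ freq a i / (1 + 4 * freq a i ^ 2) := by
    have := freq_pos ha hi
    positivity
  have hρ := div_pow_le_scaled (E := E) (n := 2 * J + 1)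
    (c := 2 * (π / 4 + (∑ k ∈ weilPrimeIndex a, (Λ k : ℝ) / Real.sqrt k) + a * (1 + weilArchDensity (2 * a)) / π)
        * (i : ℝ) ^ (2 * J) / π
      + 4 * (Real.exp (a / 2) - Real.exp (-(a / 2))) ^ 2 / π * (a ^ 2 / (4 * π ^ 2)) ^ J
        * (freq a i / (1 + 4 * freq a i ^ 2)))
    (by positivity) hm₀pos hmm' (by omega)
  exact abs_sub_le_of_row_template hε hX hF hS hA hρ (by positivity)
    (archRemainder_nonneg hm₀ ν K (2 * R + 1)
      (tsum_nonneg fun k ↦ mul_nonneg (Real.exp_nonneg _) (pow_nonneg (digammaNode_pos k).le _)))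

end Summit.RiemannHypothesis.RiemannHypothesis.Theorems.WeilFormatC
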